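import Summits.CriticalPhenomena.PercolationContinuityZ3.Theorems.PercNearOneGluingNoHeavyLowerTailKnQuestion8CoefficientwiseOneSidedDomination
import Summits.CriticalPhenomena.PercolationContinuityZ3.Theorems.PercNearOneGluingNoHeavyLowerTailKnQuestion8CoefficientwiseHarrisTwice
import HarnessLib

/-!
# THEOREM A: the two-source exclusion `Σ_{¬(y ∈ K_{xp} ∧ y ∈ K̄_x)} (g(K_{xp}) − g(K̄_x)) ≥ 0` — prim-lf-2 gen 53 (part 1 of 2)

Support file (`--supports stmt-CriticalPhenomena-4575`, closed), prover `prim-lf-2` (gen 53).  No definitions, no named facts, no sorries; standard axioms.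
Memo `prim-lf-2/CW-SERIES-gen53.md` §1; context `prim-lf-2/CW-ROOTEDGE-gen51.md` §3 (the 'series point' residue of CONJECTURE NO-CORE), `prim-lf-2/CW-BOX-gen46.md`
(CONJECTURE NO-CORE), `prim-lf-2/CW-VDBHK-gen29.md` §1 (one-sided domination, OSD).

Setting.  Finite multigraph `ends : ι → Sym2 V`, root `x`, colourings `s : Finset ι` (red) / `sᶜ` (blue), `K(s) = openCluster (ends '' s) x` (red cluster of `x`),
`K(sᶜ)` (blue cluster of `x`), and for a second source `p` the red cluster of the SET `{x,p}`, `K(s) ∪ P(s)` with `P(s) = openCluster (ends '' s) p`.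
* `offCluster_domination_cond` — ONE-SIDED DOMINATION UNDER A BLUE-INCREASING CONDITION: for every monotone `f`, every predicate `W` of the red cluster of `p`
  and every antitone weight `χ ≥ 0` of the colouring,  `Σ_{s : x ∉ P(s), W(P(s))} χ(s)·(f(K s) − f(K sᶜ)) ≤ 0`.  (gen 29's OSD `offCluster_domination` is `χ ≡ 1`.)  Proof: on each
  cell of the red cluster of `p` the red cluster of `x` lives in the free edges and is dominated by the blue cluster of the flipped colouring (`cell_sum_le_flip`); the
  antitone weight is then absorbed by FKG on the cell (`fkg_cell`) applied twice ('Harris twice').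
* `twoSource_noCore_domination` — **THEOREM A**: for all vertices `p, y` and every monotone `g`,
      `0 ≤ A(p,y)[g] := Σ_{s : ¬(y ∈ K s ∪ P s ∧ y ∈ K sᶜ)} (g(K s ∪ P s) − g(K sᶜ))`
  ('the red cluster of `{x,p}` dominates the blue cluster of `x` even after discarding the colourings in which `y` is joined to both').  Proof: after the swap
  `s ↦ sᶜ` on the blue term the summand is `[b(s)]·g(K s ∪ P s) − [b(sᶜ)]·g(K s)`; the colourings with `b(s) ≠ b(sᶜ)` pair up under the swap and leave
  `Σ_{x ∉ P s, y ∈ P s, y ∈ K sᶜ} (g(K sᶜ) − g(K s))`, which is `offCluster_domination_cond` with `W = (y ∈ ·)`, `χ = [y ∈ K sᶜ]`.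
Use (part 2, `…CoefficientwiseSeriesPoint.lean`): for a point `u` of degree two adjacent to the ROOT (`N(u) = {x,p}`),
`NO-CORE(y)[1_u,g] = NO-CORE^{G−u}(y)[1_p,g] + 2·A^{G−u}(p,y)[g]`, so THEOREM A closes the 'series point' residue: CONJECTURE NO-CORE for the point functions holds on
every graph with at most 6 vertices (prim-lf-2 code/gen53/c/nccov53.c: 80 112 `(G,y)`, 0 uncovered).  Exact checks of THEOREM A itself (prim-lf-2 code/gen53/c/acensus.c):
all `(G,p,y)` on ≤ 5 vertices and on 6 vertices with ≤ 11 edges, min over ALL monotone `g` by min-closure: 0 negatives.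
[cite: KozmaNitzan2024, Questions 8–9 (§5.5 p. 36) (context: the Question-8 pocket covariance programme)]
-/

namespace Summit.CriticalPhenomena.PercolationContinuityZ3.Theorems

open Finset Literature.Probability.Percolation

namespace Coefficientwise

variable {ι V : Type*} [Fintype ι] [DecidableEq ι] (ends : ι → Sym2 V) (x : V)

open Classical in
/-- **One-sided domination under a blue-increasing condition.**  For a finite multigraph, a root `x`, a source `p`, a monotone `f : Set V → ℝ`, any predicate `W`
evaluated at the red cluster `P(s) = C_p(s)` of `p`, and any antitone weight `χ ≥ 0` of the colouring:
  `Σ_{s : x ∉ P(s), W(P(s))} χ(s) · (f(C_x(s)) − f(C_x(sᶜ))) ≤ 0`.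
(On a cell of the red cluster of `p` — a cylinder of the cube on which `P`, hence `W`, is frozen — `C_x(s)` uses only free edges and is contained in the blue cluster of the
free-flipped colouring (`cell_sum_le_flip`), and FKG on the cell (`fkg_cell`) lets the antitone weight `χ` through: `|cell|·Σ χF ≤ (Σχ)(ΣF) ≤ (Σχ)(ΣF∘ᶜ) ≤ |cell|·Σ χ F∘ᶜ`.)
`χ ≡ 1` is gen 29's `offCluster_domination` for `A = {p}`.
[cite: VandenbergHaggstromKahn2005, Thm. 1.4 p. 5 (context: coefficientwise one-sided forms)]
[cite: KozmaNitzan2024, Questions 8–9 (§5.5 p. 36) (context)] -/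
theorem offCluster_domination_cond (p : V) (W : Set V → Prop) (f : Set V → ℝ) (hf : Monotone f)
    (χ : Finset ι → ℝ) (hχ : Antitone χ) (hχ0 : ∀ s, 0 ≤ χ s) :
    ∑ s ∈ univ.filter (fun s : Finset ι => x ∉ openCluster (ends '' (↑s : Set ι)) p ∧ W (openCluster (ends '' (↑s : Set ι)) p)),
      χ s * (f (openCluster (ends '' (↑s : Set ι)) x) - f (openCluster (ends '' (↑(sᶜ) : Set ι)) x)) ≤ 0 := by
  -- notation
  set K : Finset ι → Set V := fun s => openCluster (ends '' (↑s : Set ι)) x with hK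
  set F : Finset ι → ℝ := fun s => f (K s) with hF
  set R : Finset ι → Set V := fun s => openCluster (ends '' (↑s : Set ι)) p with hR
  set D : Finset (Finset ι) := univ.filter (fun s : Finset ι => x ∉ R s ∧ W (R s)) with hD
  change ∑ s ∈ D, χ s * (F s - F sᶜ) ≤ 0
  have hKmono : ∀ {s t : Finset ι}, s ⊆ t → K s ⊆ K t := fun hst => openCluster_image_mono ends hst x
  have hFm : Monotone F := fun s t hst => hf (hKmono hst)
  -- the edges at a vertex set, and the cell key
  set I : Set V → Finset ι := fun S => univ.filter (fun i : ι => ∃ v ∈ S, v ∈ ends i) with hI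
  set key : Finset ι → Set V × Finset ι := fun s => (R s, s ∩ I (R s)) with hkey
  have R_closed : ∀ (s : Finset ι) {u w : V}, u ∈ R s → (openGraph (ends '' (↑s : Set ι))).Adj u w → w ∈ R s := by
    intro s u w hu hadj
    exact SimpleGraph.Reachable.trans hu hadj.reachable
  have mem_I : ∀ (S : Set V) (i : ι) (v : V), v ∈ S → v ∈ ends i → i ∈ I S := by
    intro S i v hv hvi
    simp only [hI, Finset.mem_filter, Finset.mem_univ, true_and]
    exact ⟨v, hv, hvi⟩
  have p_mem_R : ∀ (s : Finset ι), p ∈ R s := fun s => mem_openCluster_self _ p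
  -- locality: a configuration agreeing with `s₀` on the edges at `R s₀` has the same red cluster of `p`
  have locality : ∀ s₀ t : Finset ι, t ∩ I (R s₀) = s₀ ∩ I (R s₀) → R t = R s₀ := by
    intro s₀ t ht
    have agree : ∀ i, i ∈ I (R s₀) → (i ∈ t ↔ i ∈ s₀) := by
      intro i hi
      have := congrArg (fun u : Finset ι => i ∈ u) ht
      simp only [Finset.mem_inter, hi, and_true, eq_iff_iff] at this
      exact this
    have h1 : ∀ u ∈ R s₀, ∀ w, (openGraph (ends '' (↑s₀ : Set ι))).Adj u w →
        (openGraph (ends '' (↑t : Set ι))).Adj u w ∧ w ∈ R s₀ := by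
      intro u hu w hadj
      refine ⟨?_, R_closed s₀ hu hadj⟩
      rw [openGraph_image_adj] at hadj ⊢
      obtain ⟨⟨i, his, hi⟩, hne⟩ := hadj
      have hiI : i ∈ I (R s₀) := mem_I _ i u hu (by rw [hi]; exact Sym2.mem_mk_left u w)
      exact ⟨⟨i, (agree i hiI).mpr his, hi⟩, hne⟩
    have h2 : ∀ u ∈ R s₀, ∀ w, (openGraph (ends '' (↑t : Set ι))).Adj u w →
        (openGraph (ends '' (↑s₀ : Set ι))).Adj u w ∧ w ∈ R s₀ := by
      intro u hu w hadj
      have hadj' : (openGraph (ends '' (↑s₀ : Set ι))).Adj u w := by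
        rw [openGraph_image_adj] at hadj ⊢
        obtain ⟨⟨i, hit, hi⟩, hne⟩ := hadj
        have hiI : i ∈ I (R s₀) := mem_I _ i u hu (by rw [hi]; exact Sym2.mem_mk_left u w)
        exact ⟨⟨i, (agree i hiI).mp hit, hi⟩, hne⟩
      exact ⟨hadj', R_closed s₀ hu hadj'⟩
    ext y
    constructor
    · intro hy
      obtain ⟨q⟩ := hy
      exact ((reachable_transfer (R s₀) h2 q) (p_mem_R s₀)).2
    · intro hy
      obtain ⟨q⟩ := hy
      exact ((reachable_transfer (R s₀) h1 q) (p_mem_R s₀)).1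
  -- split the sum over `D` along the fibres of `key`
  rw [← Finset.sum_fiberwise_of_maps_to (s := D) (t := D.image key) (g := key)
    (fun s hs => Finset.mem_image_of_mem key hs)]
  refine Finset.sum_nonpos fun k hk => ?_
  obtain ⟨s₀, hs₀D, rfl⟩ := Finset.mem_image.mp hk
  obtain ⟨hxs₀, hWs₀⟩ := (Finset.mem_filter.mp hs₀D).2
  set S₀ : Set V := R s₀ with hS₀
  set B : Finset ι := I S₀ with hB
  set π : Finset ι := s₀ ∩ B with hπ
  have hxS₀ : x ∉ S₀ := hxs₀
  -- the fibre of `key s₀` in `D` is exactly the cell `{t | t ∩ B = π}`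
  have fiber_eq : D.filter (fun t => key t = key s₀) = univ.filter (fun t : Finset ι => t ∩ B = π) := by
    ext t
    simp only [Finset.mem_filter, Finset.mem_univ, true_and]
    constructor
    · rintro ⟨_, hkt⟩
      have h1 : R t = S₀ := (Prod.ext_iff.mp hkt).1
      have h2 : t ∩ I (R t) = s₀ ∩ I (R s₀) := (Prod.ext_iff.mp hkt).2
      rw [h1] at h2
      exact h2
    · intro ht
      have hRt : R t = S₀ := locality s₀ t ht
      refine ⟨?_, ?_⟩
      · rw [hD, Finset.mem_filter]
        refine ⟨Finset.mem_univ _, ?_, ?_⟩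
        · rw [hRt]; exact hxS₀
        · rw [hRt]; exact hWs₀
      · change (R t, t ∩ I (R t)) = (R s₀, s₀ ∩ I (R s₀))
        rw [hRt]
        exact Prod.ext rfl ht
  rw [fiber_eq]
  set cell : Finset (Finset ι) := univ.filter (fun t : Finset ι => t ∩ B = π) with hcell
  -- on the cell, the red cluster of `x` uses no edge at `S₀`
  have offcluster : ∀ t : Finset ι, t ∩ B = π → K t ⊆ K ((B \ π) ∪ (t \ B)) := by
    intro t ht
    have agree : ∀ i, i ∈ B → (i ∈ t ↔ i ∈ s₀) := by
      intro i hi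
      have := congrArg (fun u : Finset ι => i ∈ u) ht
      simp only [hπ, Finset.mem_inter, hi, and_true, eq_iff_iff] at this
      exact this
    have htr : ∀ u ∈ S₀ᶜ, ∀ w, (openGraph (ends '' (↑t : Set ι))).Adj u w →
        (openGraph (ends '' (↑(t \ B) : Set ι))).Adj u w ∧ w ∈ S₀ᶜ := by
      intro u hu w hadj
      rw [openGraph_image_adj] at hadj
      obtain ⟨⟨i, hit, hi⟩, hne⟩ := hadj
      have hiB : i ∉ B := by
        intro hiB
        have his₀ : i ∈ s₀ := (agree i hiB).mp hit
        have hiB' := hiB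
        simp only [hB, hI, Finset.mem_filter, Finset.mem_univ, true_and] at hiB'
        obtain ⟨v, hvS, hvi⟩ := hiB'
        rw [hi, Sym2.mem_iff] at hvi
        rcases hvi with rfl | rfl
        · exact hu hvS
        · have hadj₀ : (openGraph (ends '' (↑s₀ : Set ι))).Adj v u := by
            rw [openGraph_image_adj]
            exact ⟨⟨i, his₀, by rw [hi, Sym2.eq_swap]⟩, hne.symm⟩
          exact hu (R_closed s₀ hvS hadj₀)
      have hwS : w ∈ S₀ᶜ := by
        intro hwS
        exact hiB (mem_I S₀ i w hwS (by rw [hi]; exact Sym2.mem_mk_right u w))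
      refine ⟨?_, hwS⟩
      rw [openGraph_image_adj]
      exact ⟨⟨i, Finset.mem_sdiff.mpr ⟨hit, hiB⟩, hi⟩, hne⟩
    intro y hy
    obtain ⟨q⟩ := hy
    have hreach := ((reachable_transfer S₀ᶜ htr q) hxS₀).1
    exact hKmono Finset.subset_union_right hreach
  -- (iii) the flip: Σ_cell F ≤ Σ_cell F∘ᶜ
  have hle : ∑ t ∈ cell, F t ≤ ∑ t ∈ cell, F tᶜ :=
    cell_sum_le_flip B π Finset.inter_subset_right F (fun t ht => hf (offcluster t ht))
  -- (i), (ii): FKG on the cell with the monotone functions `−χ`, `F`, `−F∘ᶜ`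
  have hnegχ : Monotone (fun t : Finset ι => -χ t) := fun s t hst => by
    have := hχ hst; simp only [neg_le_neg_iff]; exact this
  have hnegFc : Monotone (fun t : Finset ι => -F tᶜ) := fun s t hst => by
    have : F tᶜ ≤ F sᶜ := hFm (compl_subset_compl.mpr hst)
    simp only [neg_le_neg_iff]; exact this
  have h1 := fkg_cell B π (fun t : Finset ι => -χ t) (fun t : Finset ι => -F tᶜ) hnegχ hnegFc
  have h2 := fkg_cell B π (fun t : Finset ι => -χ t) F hnegχ hFm
  -- rewrite the FKG conclusions in terms of the four sums
  have e1 : ∑ t ∈ cell, (-χ t) = -∑ t ∈ cell, χ t := Finset.sum_neg_distrib ..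
  have e2 : ∑ t ∈ cell, (-F tᶜ) = -∑ t ∈ cell, F tᶜ := Finset.sum_neg_distrib ..
  have e3 : ∑ t ∈ cell, (-χ t) * (-F tᶜ) = ∑ t ∈ cell, χ t * F tᶜ := Finset.sum_congr rfl fun t _ => by ring
  have e4 : ∑ t ∈ cell, (-χ t) * F t = -∑ t ∈ cell, χ t * F t := by
    rw [← Finset.sum_neg_distrib]; exact Finset.sum_congr rfl fun t _ => by ring
  change (∑ t ∈ cell, (-χ t)) * (∑ t ∈ cell, (-F tᶜ)) ≤ (cell.card : ℝ) * ∑ t ∈ cell, (-χ t) * (-F tᶜ) at h1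
  change (∑ t ∈ cell, (-χ t)) * (∑ t ∈ cell, F t) ≤ (cell.card : ℝ) * ∑ t ∈ cell, (-χ t) * F t at h2
  rw [e1, e2, e3] at h1
  rw [e1, e4] at h2
  -- the cell is nonempty (it contains `s₀`), and `Σ χ ≥ 0`
  have hcard : (0 : ℝ) < (cell.card : ℝ) := by
    have : s₀ ∈ cell := by rw [hcell, Finset.mem_filter]; exact ⟨Finset.mem_univ _, rfl⟩
    exact_mod_cast Finset.card_pos.mpr ⟨s₀, this⟩
  have hχsum : 0 ≤ ∑ t ∈ cell, χ t := Finset.sum_nonneg fun t _ => hχ0 t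
  -- assemble: n·Σχ(F − F∘ᶜ) ≤ 0
  have hgoal : ∑ t ∈ cell, χ t * (F t - F tᶜ) = ∑ t ∈ cell, χ t * F t - ∑ t ∈ cell, χ t * F tᶜ := by
    rw [← Finset.sum_sub_distrib]; exact Finset.sum_congr rfl fun t _ => by ring
  rw [hgoal]
  have hmid : (∑ t ∈ cell, χ t) * (∑ t ∈ cell, F t) ≤ (∑ t ∈ cell, χ t) * (∑ t ∈ cell, F tᶜ) :=
    mul_le_mul_of_nonneg_left hle hχsum
  have key : (cell.card : ℝ) * (∑ t ∈ cell, χ t * F t - ∑ t ∈ cell, χ t * F tᶜ) ≤ 0 := by nlinarith [h1, h2, hmid]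
  rcases le_or_gt (∑ t ∈ cell, χ t * F t - ∑ t ∈ cell, χ t * F tᶜ) 0 with hcon | hcon
  · exact hcon
  · exact absurd key (not_le.mpr (mul_pos hcard hcon))

open Classical in
/-- **THEOREM A (prim-lf-2 gen 53): the two-source exclusion is nonnegative.**  For a finite multigraph, a root `x`, vertices `p, y` and every monotone `g : Set V → ℝ`,
with `K(s) = C_x(s)` and `P(s) = C_p(s)`:
  `0 ≤ Σ_{s : ¬(y ∈ K s ∪ P s ∧ y ∈ K sᶜ)} (g(K s ∪ P s) − g(K sᶜ))`.
After the swap on the blue term the sum is `Σ_s ([b s]·g(K s ∪ P s) − [b sᶜ]·g(K s))`, `b s := ¬(y ∈ K s ∪ P s ∧ y ∈ K sᶜ)`; the colourings with `b s ∧ b sᶜ` contribute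
`g(K s ∪ P s) − g(K s) ≥ 0`, the two mixed kinds are exchanged by the swap, and what is left is `Σ_{x ∉ P s, y ∈ P s, y ∈ K sᶜ} (g(K sᶜ) − g(K s)) ≥ 0` by
`offCluster_domination_cond`.  With part 2 (`noCore_seriesPoint_eq`) this settles CONJECTURE NO-CORE for the point functions at every 'series point' adjacent to the root,
and thereby on all graphs with at most six vertices.  [cite: KozmaNitzan2024, Questions 8–9 (§5.5 p. 36) (context)] -/
theorem twoSource_noCore_domination (p y : V) (g : Set V → ℝ) (hg : Monotone g) :
    0 ≤ ∑ s ∈ univ.filter (fun s : Finset ι =>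
        ¬ (y ∈ openCluster (ends '' (↑s : Set ι)) x ∪ openCluster (ends '' (↑s : Set ι)) p ∧ y ∈ openCluster (ends '' (↑(sᶜ) : Set ι)) x)),
      (g (openCluster (ends '' (↑s : Set ι)) x ∪ openCluster (ends '' (↑s : Set ι)) p) - g (openCluster (ends '' (↑(sᶜ) : Set ι)) x)) := by
  -- notation
  set K : Finset ι → Set V := fun s => openCluster (ends '' (↑s : Set ι)) x with hK
  set P : Finset ι → Set V := fun s => openCluster (ends '' (↑s : Set ι)) p with hP
  set b : Finset ι → Prop := fun s => ¬ (y ∈ K s ∪ P s ∧ y ∈ K sᶜ) with hb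
  change 0 ≤ ∑ s ∈ univ.filter (fun s : Finset ι => b s), (g (K s ∪ P s) - g (K sᶜ))
  have hKmono : ∀ {s t : Finset ι}, s ⊆ t → K s ⊆ K t := fun hst => openCluster_image_mono ends hst x
  rw [Finset.sum_filter]
  -- (a)+(b): split the summand and swap the blue term
  have hsplit : ∀ s : Finset ι, (if b s then g (K s ∪ P s) - g (K sᶜ) else 0) =
      (if b s then g (K s ∪ P s) else 0) - (if b s then g (K sᶜ) else 0) := by
    intro s; split_ifs <;> simp
  have hswap : ∑ s : Finset ι, (if b s then g (K sᶜ) else 0) = ∑ s : Finset ι, (if b sᶜ then g (K s) else 0) := by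
    rw [← sum_compl_eq (fun s : Finset ι => if b s then g (K sᶜ) else 0)]
    refine Finset.sum_congr rfl fun s _ => ?_
    simp only [compl_compl]
  rw [Finset.sum_congr rfl (fun s _ => hsplit s), Finset.sum_sub_distrib, hswap, ← Finset.sum_sub_distrib]
  -- (c): pointwise lower bound by the two mixed kinds
  have hpt : ∀ s : Finset ι, (if (b s ∧ ¬ b sᶜ) then g (K s ∪ P s) else 0) - (if (¬ b s ∧ b sᶜ) then g (K s) else 0) ≤
      (if b s then g (K s ∪ P s) else 0) - (if b sᶜ then g (K s) else 0) := by
    intro s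
    have hmono : g (K s) ≤ g (K s ∪ P s) := hg Set.subset_union_left
    by_cases h1 : b s
    · by_cases h2 : b sᶜ
      · simp [h1, h2, hmono]
      · simp [h1, h2]
    · by_cases h2 : b sᶜ
      · simp [h1, h2]
      · simp [h1, h2]
  refine le_trans ?_ (Finset.sum_le_sum fun s _ => hpt s)
  rw [Finset.sum_sub_distrib]
  -- (d): the 'good' mixed kind is the swap image of the 'bad' one
  have hgood : ∑ s : Finset ι, (if (b s ∧ ¬ b sᶜ) then g (K s ∪ P s) else 0) =
      ∑ s : Finset ι, (if (¬ b s ∧ b sᶜ) then g (K sᶜ ∪ P sᶜ) else 0) := by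
    rw [← sum_compl_eq (fun s : Finset ι => if (b s ∧ ¬ b sᶜ) then g (K s ∪ P s) else 0)]
    refine Finset.sum_congr rfl fun s _ => ?_
    simp only [compl_compl]
    by_cases h1 : b s <;> by_cases h2 : b sᶜ <;> simp [h1, h2]
  rw [hgood, ← Finset.sum_sub_distrib]
  -- (e): drop the second source on the blue side
  have hpt2 : ∀ s : Finset ι, (if (¬ b s ∧ b sᶜ) then (g (K sᶜ) - g (K s)) else 0) ≤
      (if (¬ b s ∧ b sᶜ) then g (K sᶜ ∪ P sᶜ) else 0) - (if (¬ b s ∧ b sᶜ) then g (K s) else 0) := by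
    intro s
    have hmono : g (K sᶜ) ≤ g (K sᶜ ∪ P sᶜ) := hg Set.subset_union_left
    by_cases h : (¬ b s ∧ b sᶜ)
    · rw [if_pos h, if_pos h, if_pos h]; linarith
    · simp [h]
  refine le_trans ?_ (Finset.sum_le_sum fun s _ => hpt2 s)
  -- (f): identify the 'bad' kind: `¬ b s ∧ b sᶜ ↔ (x ∉ P s ∧ y ∈ P s) ∧ y ∈ K sᶜ`
  have hbad : ∀ s : Finset ι, (¬ b s ∧ b sᶜ) ↔ ((x ∉ P s ∧ y ∈ P s) ∧ y ∈ K sᶜ) := by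
    intro s
    simp only [hb, not_not, compl_compl, Set.mem_union]
    constructor
    · rintro ⟨⟨hyR, hyKc⟩, hbc⟩
      have hyK : y ∉ K s := fun hyK => hbc ⟨Or.inl hyKc, hyK⟩
      have hyP : y ∈ P s := by
        rcases hyR with h | h
        · exact absurd h hyK
        · exact h
      refine ⟨⟨fun hxP => hyK ?_, hyP⟩, hyKc⟩
      -- `x ∈ P s` and `y ∈ P s` give `y ∈ K s`
      exact SimpleGraph.Reachable.trans (SimpleGraph.Reachable.symm hxP) hyP
    · rintro ⟨⟨hxP, hyP⟩, hyKc⟩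
      refine ⟨⟨Or.inr hyP, hyKc⟩, ?_⟩
      rintro ⟨_, hyK⟩
      -- `y ∈ K s` and `y ∈ P s` give `x ∈ P s`
      exact hxP (SimpleGraph.Reachable.trans hyP (SimpleGraph.Reachable.symm hyK))
  -- rewrite as the conditioned one-sided domination sum
  set χ : Finset ι → ℝ := fun s => if y ∈ K sᶜ then (1 : ℝ) else 0 with hχ
  have hχanti : Antitone χ := by
    intro s t hst
    simp only [hχ]
    by_cases ht : y ∈ K tᶜ
    · have hs : y ∈ K sᶜ := hKmono (compl_subset_compl.mpr hst) ht
      simp [ht, hs]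
    · simp only [ht, if_false]; split_ifs <;> norm_num
  have hχ0 : ∀ s, 0 ≤ χ s := fun s => by simp only [hχ]; split_ifs <;> norm_num
  have hosd := offCluster_domination_cond ends x p (fun S : Set V => y ∈ S) g hg χ hχanti hχ0
  rw [Finset.sum_filter] at hosd
  have hrw : ∀ s : Finset ι, (if (¬ b s ∧ b sᶜ) then (g (K sᶜ) - g (K s)) else 0) =
      -(if (x ∉ P s ∧ y ∈ P s) then χ s * (g (K s) - g (K sᶜ)) else 0) := by
    intro s
    by_cases h : (¬ b s ∧ b sᶜ)
    · obtain ⟨h1, h2⟩ := (hbad s).mp h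
      rw [if_pos h, if_pos h1]
      simp only [hχ, if_pos h2]
      ring
    · rw [if_neg h]
      by_cases h1 : (x ∉ P s ∧ y ∈ P s)
      · have h2 : y ∉ K sᶜ := fun h2 => h ((hbad s).mpr ⟨h1, h2⟩)
        rw [if_pos h1]
        simp only [hχ, if_neg h2]
        ring
      · rw [if_neg h1]
        ring
  rw [Finset.sum_congr rfl (fun s _ => hrw s), Finset.sum_neg_distrib]
  change ∑ s : Finset ι, (if (x ∉ P s ∧ y ∈ P s) then χ s * (g (K s) - g (K sᶜ)) else 0) ≤ 0 at hosd
  linarith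

end Coefficientwise

end Summit.CriticalPhenomena.PercolationContinuityZ3.Theorems
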